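import Mathlib
import HarnessLib
import Summits.MatrixMultiplication.MatrixMultiplication.Theorems.OutsiderSandwichProductPinning
import Summits.MatrixMultiplication.MatrixMultiplication.Theorems.OutsiderSandwichSubrankSix

/-!
# OutsiderSandwich — the Hamming bound `Q(cw₂^{⊠(N+2)}) ≤ 3^{N+2} - 3·2^N` for all `N`
(decomp-mm lens 4 «minimal-counterexample / extremal reduction», gen 40, kernel K40-b; THESES-FREE,
DEFINITION-FREE — imports: pencil calculus, slice gap K39-a, kernel dichotomy K39-b, `⟨7⟩ ≰ cw₂^{⊠2}` K39-c,
pinning K40-a).  `D` is ANY tensor with `hD : ∀ a b c, D a b c = if a ≠ b ∧ b ≠ c ∧ a ≠ c then 1 else 0`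
(`cw₂ ≅ D` over `ℂ`); `T(θ) = contract3 (D^{⊠(N+2)}) θ`.

**Theorem** (`add_le_of_unitTensor_le_diagPow`, `add_le_of_unitTensor_le_cwPow`, `subrank_cwPow_add_le`):
`⟨r⟩ ≤ cw₂^{⊠(N+2)} ⟹ r + 3·2^N ≤ 3^{N+2}`, i.e. `Q(cw₂^{⊠M}) ≤ 3^M - 3·2^{M-2}` (`M ≥ 2`): `Q(cw₂^{⊠2}) ≤ 6`
(K39-c = the case `N = 0`), `Q(cw₂^{⊠3}) ≤ 21`, `Q(cw₂^{⊠4}) ≤ 69`, `Q(cw₂^{⊠5}) ≤ 219`, `Q(cw₂^{⊠6}) ≤ 681`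
(previous ceilings, pencil law / slack window of gen 38: `23, 73, 227, 697`).

Proof.  A restriction `⟨r⟩ ≤ D^{⊠(N+2)}` is `B T(α_i) Cᵀ = E_ii` with `A, B, C` of row rank `r` (K39-b); put
`d = 3^{N+2} - r < 3·2^N`.  (1) Sylvester: `rank T(α_i) ≤ 2d + 1 < 1.5·2^{N+2}`, so by the **iterated slice
gap** (K40-a) `α_i = c_i · ⊗_t v_{it}` with singular factors `D(v_{it}) x̂_{it} = 0`, `col T(α_i)` is
annihilated at every position by `x̂_{it}`, and `rank T(α_i) ≥ 2^{N+2}` (minrank).  (2) **Two-sided kernel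
law** `rank M ≤ rank (B M Cᵀ) + dim (ker B ∩ col M) + dim (ker C ∩ col M)` (`M` symmetric): for each `i` one of
`ker B`, `ker C` (dimension `d`) meets `col T(α_i)` in dimension `≥ 2^{N+1}` — indices split as `I_B ∪ I_C`.
(3) `false_of_four_le`: inside `I_B`, two indices with kernel lines independent at two positions `s ≠ s'`
would give `dim (ker B ∩ col T(α_i) ∩ col T(α_j)) ≥ 2^{N+2} - d > 2^N`, against the **two-position pinning
bound** `≤ 2^N` (K40-a); dependent kernel lines mean proportional factors (rigidity, K39-a), so not all
positions are dependent (`α_i ∦ α_j`).  Hence every pair in `I_B` disagrees at EXACTLY ONE position, all pairs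
through a fixed `i₀` at the same position `s₀` (Hamming **sunflower**), and every `α_i`, `i ∈ I_B`, lies in
the `3`-space `v_{i₀,1} ⊗ ⋯ ⊗ ℂ³_{s₀} ⊗ ⋯ ⊗ v_{i₀,N+2}`: `|I_B| ≤ 3`, likewise `|I_C| ≤ 3`, so
`r ≤ 6 < 7 ≤ 3^{N+2} - 3·2^N + 1 ≤ r`.  The deficit `3·2^N` is a `(2/3)^N`-fraction of the volume (an
INSTRUMENT for the diagonal `m = 1` cells of the packing census behind `LaserTangency`, not a rung toward the
exponential leaves).

References: [cite: CoppersmithWinograd1990, §6]; [cite: ChristandlVranaZuiddam2023, §1.1];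
[cite: BurgisserClausenShokrollahi1997, Prop. 15.25]; [cite: HornJohnson2013, §0.4]; [cite: LandsbergGCT2017, §3.4.9].
-/

set_option linter.dupNamespace false

noncomputable section

namespace Summit.MatrixMultiplication.MatrixMultiplication.Theorems.OutsiderSandwichHammingBound

open Literature.Computability.AlgebraicComplexity
open Summit.MatrixMultiplication.MatrixMultiplication.Theorems.OutsiderSandwichPencilBlocks
open Summit.MatrixMultiplication.MatrixMultiplication.Theorems.OutsiderSandwichSliceGap
open Summit.MatrixMultiplication.MatrixMultiplication.Theorems.OutsiderSandwichKernelDichotomy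
open Summit.MatrixMultiplication.MatrixMultiplication.Theorems.OutsiderSandwichProductPinning
open Summit.MatrixMultiplication.MatrixMultiplication.Theorems.OutsiderSandwichSubrankSix
open scoped Matrix BigOperators

variable {D : Fin 3 → Fin 3 → Fin 3 → ℂ}

/-- A dependent pair of non-zero vectors is proportional with a non-zero factor. [folklore] -/
theorem exists_smul_ne_zero_of_not_pair {V : Type*} [AddCommGroup V] [Module ℂ V] {x y : V}
    (hx : x ≠ 0) (hy : y ≠ 0) (h : ¬ LinearIndependent ℂ ![x, y]) : ∃ e : ℂ, e ≠ 0 ∧ y = e • x := by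
  obtain ⟨e, he⟩ := exists_smul_of_not_pair hx h
  refine ⟨e, ?_, he⟩
  rintro rfl
  exact hy (by rw [he, zero_smul])

/-- Independence of a pair survives a non-zero rescaling of its first member. [folklore] -/
theorem pair_of_smul {V : Type*} [AddCommGroup V] [Module ℂ V] {a a' b : V}
    (h : LinearIndependent ℂ ![a, b]) {e : ℂ} (he : e ≠ 0) (ha' : a' = e • a) :
    LinearIndependent ℂ ![a', b] := by
  rw [LinearIndependent.pair_iff] at h ⊢
  intro s t hst
  rw [ha', smul_smul] at hst
  obtain ⟨h1, h2⟩ := h (s * e) t hst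
  exact ⟨(mul_eq_zero.mp h1).resolve_right he, h2⟩

/-- **Agreement by rigidity**: if the kernel lines `x̂, x̂'` of the singular slices `D(v)`, `D(v')`
(`v ≠ 0`) are dependent, then `v' = e · v`. [cite: CoppersmithWinograd1990, §6] -/
theorem exists_smul_of_dep (hD : ∀ a b c, D a b c = if a ≠ b ∧ b ≠ c ∧ a ≠ c then 1 else 0)
    {v v' x x' : Fin 3 → ℂ} (hv : v ≠ 0) (hx0 : x ≠ 0) (hx0' : x' ≠ 0)
    (hx : contract3 D v *ᵥ x = 0) (hx' : contract3 D v' *ᵥ x' = 0)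
    (h : ¬ LinearIndependent ℂ ![x, x']) : ∃ e : ℂ, v' = e • v := by
  obtain ⟨e, he, hxe⟩ := exists_smul_ne_zero_of_not_pair hx0 hx0' h
  have h1 : contract3 D v' *ᵥ x = 0 := by
    rw [hxe, Matrix.mulVec_smul] at hx'
    exact (smul_eq_zero.mp hx').resolve_left he
  exact exists_smul_of_common_kernel hD hx0 hv hx h1

/-- **Core contradiction (Hamming sunflower).**  `|ι| ≥ 4` independent pure products `α_i = c_i·⊗_t v_{it}`
with singular factors (`D(v_{it}) x̂_{it} = 0`) and a subspace `K`, `dim K < 3·2^N`, meeting every `col T(α_i)`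
in dimension `≥ 2^{N+1}` are contradictory (two-position pinning bound + rigidity + sunflower ⟹ all `α_i` in a
`3`-space). [cite: CoppersmithWinograd1990, §6] -/
theorem false_of_four_le (hD : ∀ a b c, D a b c = if a ≠ b ∧ b ≠ c ∧ a ≠ c then 1 else 0)
    {N : ℕ} {ι : Type*} [Fintype ι] [DecidableEq ι] (hι : 4 ≤ Fintype.card ι)
    {α : ι → (Fin (N + 2) → Fin 3) → ℂ} (hα : LinearIndependent ℂ α)
    (c : ι → ℂ) (v : ι → Fin (N + 2) → Fin 3 → ℂ)
    (hprod : ∀ i, α i = fun f => c i * ∏ t, v i t (f t))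
    (x : ι → Fin (N + 2) → Fin 3 → ℂ) (hx0 : ∀ i t, x i t ≠ 0)
    (hx : ∀ i t, contract3 D (v i t) *ᵥ x i t = 0)
    (K : Submodule ℂ ((Fin (N + 2) → Fin 3) → ℂ)) (hK : Module.finrank ℂ K < 3 * 2 ^ N)
    (hKI : ∀ i, 2 ^ (N + 1) ≤ Module.finrank ℂ
      ↥(K ⊓ LinearMap.range (contract3 (kroneckerPow D (N + 2)) (α i)).mulVecLin)) : False := by
  classical
  have hv0 : ∀ i t, v i t ≠ 0 := fun i t => factor_ne_zero (hprod i) (hα.ne_zero i) t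
  have h2 : 2 ^ (N + 1) = 2 * 2 ^ N := by ring
  -- annihilation of `K ⊓ col T(α_i)` at every position
  have hann : ∀ i, ∀ u ∈ K ⊓ LinearMap.range (contract3 (kroneckerPow D (N + 2)) (α i)).mulVecLin,
      ∀ t w, ∑ b, x i t b * u (Function.update w t b) = 0 := by
    intro i u hu t w
    obtain ⟨u₀, hu₀⟩ := LinearMap.mem_range.mp (Submodule.mem_inf.mp hu).2
    rw [← hu₀, Matrix.mulVecLin_apply, hprod i]
    exact pureProd_vanish hD (N + 2) (c i) (v i) t (hx i t) u₀ w
  -- (a) two independent positions are impossible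
  have hA : ∀ i j, ∀ s s' : Fin (N + 2), s ≠ s' → LinearIndependent ℂ ![x i s, x j s] →
      LinearIndependent ℂ ![x i s', x j s'] → False := by
    intro i j s s' hss hs hs'
    have hdim := Submodule.finrank_sup_add_finrank_inf_eq
      (K ⊓ LinearMap.range (contract3 (kroneckerPow D (N + 2)) (α i)).mulVecLin)
      (K ⊓ LinearMap.range (contract3 (kroneckerPow D (N + 2)) (α j)).mulVecLin)
    have hsup : Module.finrank ℂ
        ↥(K ⊓ LinearMap.range (contract3 (kroneckerPow D (N + 2)) (α i)).mulVecLin ⊔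
          K ⊓ LinearMap.range (contract3 (kroneckerPow D (N + 2)) (α j)).mulVecLin) ≤
        Module.finrank ℂ K :=
      Submodule.finrank_mono (sup_le inf_le_left inf_le_left)
    have hle := finrank_le_two_pow_of_two_positions N (x i) (x j) (hx0 i) hss hs hs'
      (K ⊓ LinearMap.range (contract3 (kroneckerPow D (N + 2)) (α i)).mulVecLin ⊓
        (K ⊓ LinearMap.range (contract3 (kroneckerPow D (N + 2)) (α j)).mulVecLin))
      fun u hu t w => ⟨hann i u (Submodule.mem_inf.mp hu).1 t w,
        hann j u (Submodule.mem_inf.mp hu).2 t w⟩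
    have hi := hKI i
    have hj := hKI j
    omega
  -- (b) some position is independent (else the pair is proportional, by rigidity)
  have hB : ∀ i j, i ≠ j → ∃ s, LinearIndependent ℂ ![x i s, x j s] := by
    intro i j hij
    by_contra h
    push Not at h
    have he : ∀ t, ∃ e : ℂ, v j t = e • v i t := fun t =>
      exists_smul_of_dep hD (hv0 i t) (hx0 i t) (hx0 j t) (hx i t) (hx j t) (h t)
    choose e he using he
    have hci : c i ≠ 0 := scalar_ne_zero (hprod i) (hα.ne_zero i)
    have hij' : α j = (c j * (∏ t, e t) * (c i)⁻¹) • α i := by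
      rw [hprod i, hprod j]
      funext f
      have hin : ∏ t, v j t (f t) = (∏ t, e t) * ∏ t, v i t (f t) := by
        rw [← Finset.prod_mul_distrib]
        exact Finset.prod_congr rfl fun t _ => by rw [he t, Pi.smul_apply, smul_eq_mul]
      simp only [Pi.smul_apply, smul_eq_mul, hin]
      field_simp
    have hpair : LinearIndependent ℂ ![α i, α j] := by
      have h1 := hα.comp ![i, j] fun a b hab => by
        fin_cases a <;> fin_cases b <;> simp_all
      have h2 : α ∘ ![i, j] = ![α i, α j] := by
        funext k; fin_cases k <;> rfl
      rw [h2] at h1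
      exact h1
    exact (LinearIndependent.pair_iff' (hα.ne_zero i)).mp hpair _ hij'.symm
  choose s hs using hB
  -- the independent position of a pair is unique
  have huniq : ∀ i j (hij : i ≠ j) t, LinearIndependent ℂ ![x i t, x j t] → t = s i j hij := by
    intro i j hij t ht
    by_contra hne
    exact hA i j t (s i j hij) hne ht (hs i j hij)
  have hdep : ∀ i j (hij : i ≠ j) t, t ≠ s i j hij → ∃ e : ℂ, v j t = e • v i t := by
    intro i j hij t ht
    exact exists_smul_of_dep hD (hv0 i t) (hx0 i t) (hx0 j t) (hx i t) (hx j t)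
      fun h => ht (huniq i j hij t h)
  -- fix `i₀` and `j₁ ≠ i₀`; the common position `s₀`
  obtain ⟨i₀⟩ : Nonempty ι := Fintype.card_pos_iff.mp (by omega)
  obtain ⟨j₁, hj₁⟩ := Fintype.exists_ne_of_one_lt_card (by omega : 1 < Fintype.card ι) i₀
  have hj₁' : i₀ ≠ j₁ := fun h => hj₁ h.symm
  -- (c) sunflower: every pair through `i₀` is independent exactly at `s₀ := s i₀ j₁`
  have hsun : ∀ j (hj : i₀ ≠ j), s i₀ j hj = s i₀ j₁ hj₁' := by
    intro j hj
    by_contra hne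
    have hjj₁ : j ≠ j₁ := by
      rintro rfl
      exact hne rfl
    obtain ⟨e, he0, he⟩ : ∃ e : ℂ, e ≠ 0 ∧ x j (s i₀ j₁ hj₁') = e • x i₀ (s i₀ j₁ hj₁') :=
      exists_smul_ne_zero_of_not_pair (hx0 i₀ _) (hx0 j _) fun h => hne (huniq i₀ j hj _ h).symm
    have h1 : LinearIndependent ℂ ![x j (s i₀ j₁ hj₁'), x j₁ (s i₀ j₁ hj₁')] :=
      pair_of_smul (hs i₀ j₁ hj₁') he0 he
    obtain ⟨e', he0', he'⟩ : ∃ e' : ℂ, e' ≠ 0 ∧ x j₁ (s i₀ j hj) = e' • x i₀ (s i₀ j hj) :=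
      exists_smul_ne_zero_of_not_pair (hx0 i₀ _) (hx0 j₁ _) fun h => hne (huniq i₀ j₁ hj₁' _ h)
    have h2 : LinearIndependent ℂ ![x j (s i₀ j hj), x j₁ (s i₀ j hj)] :=
      LinearIndependent.pair_symm_iff.mp (pair_of_smul (hs i₀ j hj) he0' he')
    exact hA j j₁ (s i₀ j₁ hj₁') (s i₀ j hj) (fun h => hne h.symm) h1 h2
  -- (d) every factor off `s₀` is proportional to the corresponding factor of `i₀`
  have hprop : ∀ j t, ∃ e : ℂ, t ≠ s i₀ j₁ hj₁' → v j t = e • v i₀ t := by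
    intro j t
    by_cases hj : i₀ = j
    · subst hj
      exact ⟨1, fun _ => (one_smul _ _).symm⟩
    · by_cases ht : t = s i₀ j₁ hj₁'
      · exact ⟨0, fun h => absurd ht h⟩
      · obtain ⟨e, he⟩ := hdep i₀ j hj t (by rw [hsun j hj]; exact ht)
        exact ⟨e, fun _ => he⟩
  choose e he using hprop
  -- so all `α_j` lie in the `3`-space `Ψ(ℂ³)`
  let Ψ : (Fin 3 → ℂ) →ₗ[ℂ] ((Fin (N + 2) → Fin 3) → ℂ) :=
    { toFun := fun m f => m (f (s i₀ j₁ hj₁')) *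
        ∏ t ∈ Finset.univ.erase (s i₀ j₁ hj₁'), v i₀ t (f t)
      map_add' := fun m m' => by funext f; simp [add_mul]
      map_smul' := fun a m => by funext f; simp [mul_assoc] }
  have hmem : ∀ j, α j ∈ LinearMap.range Ψ := by
    intro j
    refine ⟨(c j * ∏ t ∈ Finset.univ.erase (s i₀ j₁ hj₁'), e j t) • v j (s i₀ j₁ hj₁'), ?_⟩
    rw [hprod j]
    funext f
    simp only [Ψ, LinearMap.coe_mk, AddHom.coe_mk, Pi.smul_apply, smul_eq_mul]
    rw [← Finset.mul_prod_erase Finset.univ (fun t => v j t (f t)) (Finset.mem_univ (s i₀ j₁ hj₁'))]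
    have hin : ∏ t ∈ Finset.univ.erase (s i₀ j₁ hj₁'), v j t (f t) =
        (∏ t ∈ Finset.univ.erase (s i₀ j₁ hj₁'), e j t) *
          ∏ t ∈ Finset.univ.erase (s i₀ j₁ hj₁'), v i₀ t (f t) := by
      rw [← Finset.prod_mul_distrib]
      refine Finset.prod_congr rfl fun t ht => ?_
      rw [he j t (Finset.ne_of_mem_erase ht), Pi.smul_apply, smul_eq_mul]
    rw [hin]
    ring
  have := card_le_finrank_of_mem_range hα Ψ hmem
  simp only [Module.finrank_fintype_fun_eq_card, Fintype.card_fin] at this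
  omega

/-- **Two-sided kernel law**: for a symmetric `M` and any `B, C`,
`rank M ≤ rank (B M Cᵀ) + dim (ker B ∩ col M) + dim (ker C ∩ col M)`
(rank–nullity on `col M` twice; `col (M Bᵀ) ⊆ col M`). [cite: HornJohnson2013, §0.4] -/
theorem rank_le_of_sandwich {n : Type*} [Fintype n] [DecidableEq n] {r : ℕ} (B C : Fin r → n → ℂ)
    (M : Matrix n n ℂ) (hM : Mᵀ = M) :
    M.rank ≤ (Matrix.of B * M * (Matrix.of C)ᵀ).rank +
      Module.finrank ℂ ↥(LinearMap.ker (Matrix.of B).mulVecLin ⊓ LinearMap.range M.mulVecLin) +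
      Module.finrank ℂ ↥(LinearMap.ker (Matrix.of C).mulVecLin ⊓ LinearMap.range M.mulVecLin) := by
  have h1 := rank_mul_add_finrank_ker_inf (Matrix.of B) M
  have h2 := rank_mul_add_finrank_ker_inf (Matrix.of C) (M * (Matrix.of B)ᵀ)
  have h3 : (M * (Matrix.of B)ᵀ).rank = (Matrix.of B * M).rank := by
    rw [← Matrix.rank_transpose (Matrix.of B * M), Matrix.transpose_mul, hM]
  have h4 : (Matrix.of C * (M * (Matrix.of B)ᵀ)).rank = (Matrix.of B * M * (Matrix.of C)ᵀ).rank := by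
    rw [← Matrix.rank_transpose (Matrix.of B * M * (Matrix.of C)ᵀ), Matrix.transpose_mul,
      Matrix.transpose_mul, Matrix.transpose_transpose, hM]
  have h5 : Module.finrank ℂ ↥(LinearMap.ker (Matrix.of C).mulVecLin ⊓
        LinearMap.range (M * (Matrix.of B)ᵀ).mulVecLin) ≤
      Module.finrank ℂ ↥(LinearMap.ker (Matrix.of C).mulVecLin ⊓ LinearMap.range M.mulVecLin) := by
    refine Submodule.finrank_mono (inf_le_inf_left _ ?_)
    rw [Matrix.mulVecLin_mul]
    exact LinearMap.range_comp_le_range _ _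
  omega

/-- **Hamming bound, `D`-form.**  `⟨r⟩ ≤ D^{⊠(N+2)} ⟹ r + 3·2^N ≤ 3^{N+2}`: a restriction of the
`(N+2)`-nd Kronecker power of the (diagonalised) Coppersmith–Winograd tensor onto a unit tensor misses
at least `3·2^N` of the `3^{N+2}` dimensions. [cite: ChristandlVranaZuiddam2023, §1.1] -/
theorem add_le_of_unitTensor_le_diagPow
    (hD : ∀ a b c, D a b c = if a ≠ b ∧ b ≠ c ∧ a ≠ c then 1 else 0) (N r : ℕ)
    (h : TensorRestrictsTo (kroneckerPow D (N + 2)) (unitTensor ℂ r)) :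
    r + 3 * 2 ^ N ≤ 3 ^ (N + 2) := by
  classical
  by_contra hlt
  push Not at hlt
  obtain ⟨A, B, C, hs⟩ := h
  have hA : LinearIndependent ℂ A := linearIndependent_fst hs
  have hB : LinearIndependent ℂ B := linearIndependent_snd hs
  have hC : LinearIndependent ℂ C := linearIndependent_trd hs
  have hsand := sandwich_eq hs
  have hn : Fintype.card (Fin (N + 2) → Fin 3) = 3 ^ (N + 2) := by simp
  have hrk : ∀ {E : Fin r → (Fin (N + 2) → Fin 3) → ℂ}, LinearIndependent ℂ E →
      (Matrix.of E).rank = r ∧ Module.finrank ℂ (LinearMap.ker (Matrix.of E).mulVecLin) + r = 3 ^ (N + 2) := by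
    intro E hE
    have hr : (Matrix.of E).rank = r := by
      rw [Matrix.rank_eq_finrank_span_row, show (Matrix.of E).row = E from rfl,
        finrank_span_eq_card hE, Fintype.card_fin]
    have h := LinearMap.finrank_range_add_finrank_ker (Matrix.of E).mulVecLin
    rw [Module.finrank_fintype_fun_eq_card, hn] at h
    change (Matrix.of E).rank + _ = _ at h
    exact ⟨hr, by omega⟩
  obtain ⟨hrB, hkB⟩ := hrk hB
  obtain ⟨hrC, hkC⟩ := hrk hC
  -- Sylvester: `rank T(α_i) + 2 r ≤ 1 + 2 · 3^(N+2)`, so `2 · rank T(α_i) < 3 · 2^(N+2)`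
  have hT : ∀ i, (contract3 (kroneckerPow D (N + 2)) (A i)).rank + 2 * r ≤ 1 + 2 * 3 ^ (N + 2) := by
    intro i
    have h1 := Literature.LinearAlgebra.Matrix.rank_add_rank_le_rank_mul_add_card (Matrix.of B)
      (contract3 (kroneckerPow D (N + 2)) (A i))
    have h2 := Literature.LinearAlgebra.Matrix.rank_add_rank_le_rank_mul_add_card
      (Matrix.of B * contract3 (kroneckerPow D (N + 2)) (A i)) (Matrix.of C)ᵀ
    have h3 : (Matrix.of B * contract3 (kroneckerPow D (N + 2)) (A i) * (Matrix.of C)ᵀ).rank ≤ 1 := by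
      rw [hsand i]
      exact rank_of_unitTensor_le r i
    rw [Matrix.rank_transpose, hrC, hn] at h2
    rw [hrB, hn] at h1
    omega
  have h4 : 2 ^ (N + 2) = 4 * 2 ^ N := by ring
  have hgap : ∀ i, 2 * (contract3 (kroneckerPow D (N + 2)) (A i)).rank < 3 * 2 ^ (N + 2) := by
    intro i
    have := hT i
    omega
  -- the iterated slice gap: pure products with singular factors
  choose c v hprod hker using fun i =>
    exists_pureProd_of_rank_lt hD (N + 2) (A i) (hA.ne_zero i) (hgap i)
  choose x hx0 hx using hker
  -- minrank and the two-sided kernel law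
  have hsum : ∀ i, 2 ^ (N + 2) ≤ 1 +
      Module.finrank ℂ ↥(LinearMap.ker (Matrix.of B).mulVecLin ⊓
        LinearMap.range (contract3 (kroneckerPow D (N + 2)) (A i)).mulVecLin) +
      Module.finrank ℂ ↥(LinearMap.ker (Matrix.of C).mulVecLin ⊓
        LinearMap.range (contract3 (kroneckerPow D (N + 2)) (A i)).mulVecLin) := by
    intro i
    have hfl := two_pow_le_rank_slice hD (N + 2) (hA.ne_zero i)
    have hlaw := rank_le_of_sandwich B C _ (slice_transpose hD (N + 2) (A i))
    have h3 : (Matrix.of B * contract3 (kroneckerPow D (N + 2)) (A i) * (Matrix.of C)ᵀ).rank ≤ 1 := by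
      rw [hsand i]
      exact rank_of_unitTensor_le r i
    omega
  -- split the indices according to which kernel meets the column space in half dimension
  let SB : Finset (Fin r) := Finset.univ.filter fun i => 2 ^ (N + 1) ≤
    Module.finrank ℂ ↥(LinearMap.ker (Matrix.of B).mulVecLin ⊓
      LinearMap.range (contract3 (kroneckerPow D (N + 2)) (A i)).mulVecLin)
  let SC : Finset (Fin r) := Finset.univ.filter fun i => 2 ^ (N + 1) ≤
    Module.finrank ℂ ↥(LinearMap.ker (Matrix.of C).mulVecLin ⊓
      LinearMap.range (contract3 (kroneckerPow D (N + 2)) (A i)).mulVecLin)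
  have h2 : 2 ^ (N + 1) = 2 * 2 ^ N := by ring
  have hunion : SB ∪ SC = Finset.univ := by
    ext i
    simp only [SB, SC, Finset.mem_union, Finset.mem_filter, Finset.mem_univ, true_and, iff_true]
    have := hsum i
    omega
  have hcard : r ≤ SB.card + SC.card := by
    have := Finset.card_union_le SB SC
    rw [hunion, Finset.card_univ, Fintype.card_fin] at this
    exact this
  have h7 : 7 ≤ r := by
    have hp : 2 ^ N ≤ 3 ^ N := Nat.pow_le_pow_left (by norm_num) N
    have h1 : 1 ≤ 3 ^ N := Nat.one_le_pow _ _ (by norm_num)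
    have h9 : 3 ^ (N + 2) = 9 * 3 ^ N := by ring
    omega
  -- a family of `≥ 4` indices on one side contradicts `false_of_four_le`
  have hfin : ∀ (K : Submodule ℂ ((Fin (N + 2) → Fin 3) → ℂ)), Module.finrank ℂ K < 3 * 2 ^ N →
      ∀ S : Finset (Fin r), 4 ≤ S.card → (∀ i ∈ S, 2 ^ (N + 1) ≤ Module.finrank ℂ
        ↥(K ⊓ LinearMap.range (contract3 (kroneckerPow D (N + 2)) (A i)).mulVecLin)) → False :=
    fun K hK S hS hmem => false_of_four_le hD (ι := ↥S) (by simpa using hS)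
      (hα := hA.comp Subtype.val Subtype.val_injective) (fun i => c i) (fun i => v i)
      (fun i => hprod i) (fun i => x i) (fun i t => hx0 i t) (fun i t => hx i t) K hK fun i => hmem i i.2
  by_cases hSB : 4 ≤ SB.card
  · exact hfin _ (by omega) SB hSB fun i hi => (Finset.mem_filter.mp hi).2
  · exact hfin _ (by omega) SC (by omega) fun i hi => (Finset.mem_filter.mp hi).2

/-- `⟨r⟩ ≰ D^{⊠(N+2)}` as soon as `r + 3·2^N > 3^{N+2}`. [cite: ChristandlVranaZuiddam2023, §1.1] -/
theorem not_unitTensor_le_diagPow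
    (hD : ∀ a b c, D a b c = if a ≠ b ∧ b ≠ c ∧ a ≠ c then 1 else 0) (N r : ℕ)
    (hr : 3 ^ (N + 2) < r + 3 * 2 ^ N) :
    ¬ TensorRestrictsTo (kroneckerPow D (N + 2)) (unitTensor ℂ r) := fun h =>
  absurd (add_le_of_unitTensor_le_diagPow hD N r h) (not_le.mpr hr)

/-- **`D^{⊠N} ≥ cw₂^{⊠N}`** over `ℂ`: `cw₂ = (M, M, M) · D` with `M = [[1/2,0,0],[0,1,1],[0,i,-i]]`
(as cubic forms `3x₀(x₁²+x₂²) = 6 (x₀/2)(x₁+ix₂)(x₁-ix₂)`), raised to the `N`-th Kronecker power.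
[cite: LandsbergGCT2017, §3.4.9] -/
theorem diagPow_restrictsTo_cwPow
    (hD : ∀ a b c, D a b c = if a ≠ b ∧ b ≠ c ∧ a ≠ c then 1 else 0) (N : ℕ) :
    TensorRestrictsTo (kroneckerPow D N) (kroneckerPow (cwTensor ℂ 2) N) := by
  have base : TensorRestrictsTo D (cwTensor ℂ 2) := by
    refine ⟨!![(1/2 : ℂ), 0, 0; 0, 1, 1; 0, Complex.I, -Complex.I],
      !![(1/2 : ℂ), 0, 0; 0, 1, 1; 0, Complex.I, -Complex.I],
      !![(1/2 : ℂ), 0, 0; 0, 1, 1; 0, Complex.I, -Complex.I], fun a' b' c' => ?_⟩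
    rw [cwTensor_apply]
    simp only [Fin.sum_univ_three, hD]
    fin_cases a' <;> fin_cases b' <;> fin_cases c' <;> simp <;> ring_nf <;> simp [Complex.I_sq]
  exact base.kroneckerPow N

/-- **Hamming bound for `cw₂`**: `⟨r⟩ ≤ cw₂^{⊠(N+2)} ⟹ r + 3·2^N ≤ 3^{N+2}`.
[cite: ChristandlVranaZuiddam2023, §1.1] -/
theorem add_le_of_unitTensor_le_cwPow (N r : ℕ)
    (h : TensorRestrictsTo (kroneckerPow (cwTensor ℂ 2) (N + 2)) (unitTensor ℂ r)) :
    r + 3 * 2 ^ N ≤ 3 ^ (N + 2) := by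
  let D' : Fin 3 → Fin 3 → Fin 3 → ℂ := fun a b c => if a ≠ b ∧ b ≠ c ∧ a ≠ c then 1 else 0
  have hD' : ∀ a b c, D' a b c = if a ≠ b ∧ b ≠ c ∧ a ≠ c then 1 else 0 := fun _ _ _ => rfl
  exact add_le_of_unitTensor_le_diagPow hD' N r ((diagPow_restrictsTo_cwPow hD' (N + 2)).trans h)

/-- **Subrank ceiling** `Q(cw₂^{⊠(N+2)}) + 3·2^N ≤ 3^{N+2}`, i.e. `Q(cw₂^{⊠M}) ≤ 3^M - 3·2^{M-2}` for
`M ≥ 2` (at `M = 2` this is K39-c's `Q(cw₂^{⊠2}) ≤ 6`). [cite: ChristandlVranaZuiddam2023, §1.1] -/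
theorem subrank_cwPow_add_le (N : ℕ) :
    subrank ℂ (kroneckerPow (cwTensor ℂ 2) (N + 2)) + 3 * 2 ^ N ≤ 3 ^ (N + 2) :=
  add_le_of_unitTensor_le_cwPow N _
    (Literature.Barriers.MatrixMultiplication.restrictsTo_unitTensor_subrank _)

/-- Census cell `N = 3`: `Q(cw₂^{⊠3}) ≤ 21` (was `≤ 23`; floor `14`). [cite: ChristandlVranaZuiddam2023, §1.1] -/
theorem subrank_cwPow_three_le : subrank ℂ (kroneckerPow (cwTensor ℂ 2) 3) ≤ 21 := by
  have h : subrank ℂ (kroneckerPow (cwTensor ℂ 2) 3) + 3 * 2 ^ 1 ≤ 3 ^ 3 := subrank_cwPow_add_le 1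
  norm_num at h; omega

/-- Census cell `N = 4`: `Q(cw₂^{⊠4}) ≤ 69` (was `≤ 73`; floor `36`). [cite: ChristandlVranaZuiddam2023, §1.1] -/
theorem subrank_cwPow_four_le : subrank ℂ (kroneckerPow (cwTensor ℂ 2) 4) ≤ 69 := by
  have h : subrank ℂ (kroneckerPow (cwTensor ℂ 2) 4) + 3 * 2 ^ 2 ≤ 3 ^ 4 := subrank_cwPow_add_le 2
  norm_num at h; omega

/-- Census cell `N = 5`: `Q(cw₂^{⊠5}) ≤ 219` (was `≤ 227`; floor `84`). [cite: ChristandlVranaZuiddam2023, §1.1] -/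
theorem subrank_cwPow_five_le : subrank ℂ (kroneckerPow (cwTensor ℂ 2) 5) ≤ 219 := by
  have h : subrank ℂ (kroneckerPow (cwTensor ℂ 2) 5) + 3 * 2 ^ 3 ≤ 3 ^ 5 := subrank_cwPow_add_le 3
  norm_num at h; omega

/-- Census cell `N = 6`: `Q(cw₂^{⊠6}) ≤ 681` (was `≤ 697`; floor `216`). [cite: ChristandlVranaZuiddam2023, §1.1] -/
theorem subrank_cwPow_six_le : subrank ℂ (kroneckerPow (cwTensor ℂ 2) 6) ≤ 681 := by
  have h : subrank ℂ (kroneckerPow (cwTensor ℂ 2) 6) + 3 * 2 ^ 4 ≤ 3 ^ 6 := subrank_cwPow_add_le 4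
  norm_num at h; omega

end Summit.MatrixMultiplication.MatrixMultiplication.Theorems.OutsiderSandwichHammingBound
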